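import Mathlib.Topology.Algebra.Order.Floor
import Mathlib.Topology.MetricSpace.Lipschitz
import Mathlib.Analysis.Normed.Order.Lattice
import Mathlib.Analysis.Normed.Field.Basic
import Mathlib.Algebra.BigOperators.Fin
import Mathlib.Order.Monotone.Union
import Mathlib.Topology.UnitInterval
import HarnessLib

/-!
# Piecewise-affine lifts of circle homeomorphisms through four prescribed points

Topic `Literature/Topology/PlaneTopology`.  Given four points on the circle `ℝ/ℤ` in cyclic order,
`x₀ < x₁ < x₂ < x₃ < x₀ + 1`, and four target points `y₀ < y₁ < y₂ < y₃ < y₀ + 1`, the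
**piecewise-affine lift** `K : ℝ → ℝ` — affine from `[x_j, x_{j+1}]` onto `[y_j, y_{j+1}]`,
extended by `K (t + 1) = K t + 1` — is a strictly increasing bi-Lipschitz homeomorphism of `ℝ`
commuting with the deck translation, with `K x_j = y_j`; it descends to a bi-Lipschitz
homeomorphism of the circle moving the four points `x_j` to `y_j` and the four arcs onto the
four arcs (`FourPointCircleMap.lean`).  Elementary ("connect the dots"); recorded because general
position in Schramm–Smirnov's Theorem 1.7 needs a Lipschitz-controlled homeomorphism of the disc
carrying four boundary points to the four corner directions of a conformal square.

* `FourKnots` — the data; `FourKnots.spline` — the monotone spline on the fundamental interval in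
  closed form `y₀ + Σ_j s_j (clamp_{[x_j,x_{j+1}]} t - x_j)`; `spline_eq_of_mem` (affine on each
  piece), `spline_apply_x` (interpolation), monotone / Lipschitz / strictly monotone;
* `FourKnots.swap` and `spline_swap_spline` — the inverse spline;
* `FourKnots.lift` — the equivariant extension `K`, `lift_add_one`, `continuous_lift`,
  `strictMono_lift`, `lipschitzWith_lift`, `lift_swap_lift` (two-sided inverse).

## References

* [folklore]; used for O. Schramm, S. Smirnov, Ann. Probab. 39 (2011), proof of Thm. 1.7
  (general position). [SchrammSmirnov2011]
-/

noncomputable section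

open Set
open scoped unitInterval NNReal

namespace Literature.Topology.PlaneTopology

/-- **Four knots on the circle and their targets**: `x₀ < x₁ < x₂ < x₃ < x₀ + 1` (sources) and
`y₀ < y₁ < y₂ < y₃ < y₀ + 1` (targets), as real representatives. [folklore] -/
structure FourKnots where
  x : Fin 4 → ℝ
  y : Fin 4 → ℝ
  hx01 : x 0 < x 1
  hx12 : x 1 < x 2
  hx23 : x 2 < x 3
  hx30 : x 3 < x 0 + 1
  hy01 : y 0 < y 1
  hy12 : y 1 < y 2
  hy23 : y 2 < y 3
  hy30 : y 3 < y 0 + 1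

namespace FourKnots

variable (F : FourKnots)

/-- The fifth knot `x₄ = x₀ + 1` (sources extended by one period). [folklore] -/
def xe (j : Fin 5) : ℝ := if h : (j : ℕ) < 4 then F.x ⟨j, h⟩ else F.x 0 + 1

/-- The fifth knot `y₄ = y₀ + 1`. [folklore] -/
def ye (j : Fin 5) : ℝ := if h : (j : ℕ) < 4 then F.y ⟨j, h⟩ else F.y 0 + 1

/-- Structural lemma for the four-knot data. [folklore] -/
@[simp] theorem xe_zero : F.xe 0 = F.x 0 := rfl
/-- Structural lemma for the four-knot data. [folklore] -/
@[simp] theorem xe_one : F.xe 1 = F.x 1 := rfl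
/-- Structural lemma for the four-knot data. [folklore] -/
@[simp] theorem xe_two : F.xe 2 = F.x 2 := rfl
/-- Structural lemma for the four-knot data. [folklore] -/
@[simp] theorem xe_three : F.xe 3 = F.x 3 := rfl
/-- Structural lemma for the four-knot data. [folklore] -/
@[simp] theorem xe_four : F.xe 4 = F.x 0 + 1 := rfl
/-- Structural lemma for the four-knot data. [folklore] -/
@[simp] theorem ye_zero : F.ye 0 = F.y 0 := rfl
/-- Structural lemma for the four-knot data. [folklore] -/
@[simp] theorem ye_one : F.ye 1 = F.y 1 := rfl
/-- Structural lemma for the four-knot data. [folklore] -/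
@[simp] theorem ye_two : F.ye 2 = F.y 2 := rfl
/-- Structural lemma for the four-knot data. [folklore] -/
@[simp] theorem ye_three : F.ye 3 = F.y 3 := rfl
/-- Structural lemma for the four-knot data. [folklore] -/
@[simp] theorem ye_four : F.ye 4 = F.y 0 + 1 := rfl
/-- Structural lemma for the four-knot data. [folklore] -/
@[simp] theorem xe_castSucc (j : Fin 4) : F.xe j.castSucc = F.x j := by
  unfold xe; simp [j.is_lt]
/-- Structural lemma for the four-knot data. [folklore] -/
@[simp] theorem ye_castSucc (j : Fin 4) : F.ye j.castSucc = F.y j := by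
  unfold ye; simp [j.is_lt]

/-- The slopes `s_j = (y_{j+1} - y_j)/(x_{j+1} - x_j) > 0`. [folklore] -/
def slope (j : Fin 4) : ℝ := (F.ye j.succ - F.ye j.castSucc) / (F.xe j.succ - F.xe j.castSucc)

/-- Consecutive source knots increase. [folklore] -/
theorem xe_lt_succ (j : Fin 4) : F.xe j.castSucc < F.xe j.succ := by
  fin_cases j
  · exact F.hx01
  · exact F.hx12
  · exact F.hx23
  · exact F.hx30

/-- Consecutive target knots increase. [folklore] -/
theorem ye_lt_succ (j : Fin 4) : F.ye j.castSucc < F.ye j.succ := by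
  fin_cases j
  · exact F.hy01
  · exact F.hy12
  · exact F.hy23
  · exact F.hy30

/-- The source knots increase. [folklore] -/
theorem xe_mono : StrictMono F.xe := by
  refine Fin.strictMono_iff_lt_succ.2 fun j => ?_
  exact F.xe_lt_succ j

/-- The target knots increase. [folklore] -/
theorem ye_mono : StrictMono F.ye := by
  refine Fin.strictMono_iff_lt_succ.2 fun j => ?_
  exact F.ye_lt_succ j

/-- The slopes are positive. [folklore] -/
theorem slope_pos (j : Fin 4) : 0 < F.slope j :=
  div_pos (sub_pos.2 (F.ye_lt_succ j)) (sub_pos.2 (F.xe_lt_succ j))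

/-- Clamping to `[a, b]`. [folklore] -/
def clampI (a b t : ℝ) : ℝ := max a (min t b)

/-- Structural lemma for the four-knot data. [folklore] -/
theorem clampI_of_le {a b t : ℝ} (h : t ≤ a) : clampI a b t = a := by
  unfold clampI; rw [max_eq_left]; exact (min_le_left _ _).trans h

/-- Structural lemma for the four-knot data. [folklore] -/
theorem clampI_of_ge {a b t : ℝ} (hab : a ≤ b) (h : b ≤ t) : clampI a b t = b := by
  unfold clampI; rw [min_eq_right h, max_eq_right hab]

/-- Structural lemma for the four-knot data. [folklore] -/
theorem clampI_of_mem {a b t : ℝ} (h : t ∈ Icc a b) : clampI a b t = t := by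
  unfold clampI; rw [min_eq_left h.2, max_eq_right h.1]

/-- Structural lemma for the four-knot data. [folklore] -/
theorem monotone_clampI (a b : ℝ) : Monotone (clampI a b) := fun _ _ hst =>
  max_le_max le_rfl (min_le_min hst le_rfl)

/-- Structural lemma for the four-knot data. [folklore] -/
theorem lipschitzWith_clampI (a b : ℝ) : LipschitzWith 1 (clampI a b) :=
  (LipschitzWith.id.min_const b).const_max a

/-- **The monotone spline** through `(x_j, y_j)`, `j = 0, …, 4`, in closed form. [folklore] -/
def spline (t : ℝ) : ℝ :=
  F.y 0 + ∑ j : Fin 4, F.slope j * (clampI (F.xe j.castSucc) (F.xe j.succ) t - F.xe j.castSucc)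

/-- **The spline is affine on each piece**: for `t ∈ [x_k, x_{k+1}]`,
`spline t = y_k + s_k (t - x_k)`. [folklore] -/
theorem spline_eq_of_mem (k : Fin 4) {t : ℝ} (ht : t ∈ Icc (F.xe k.castSucc) (F.xe k.succ)) :
    F.spline t = F.ye k.castSucc + F.slope k * (t - F.xe k.castSucc) := by
  -- each term evaluates explicitly
  have hterm : ∀ j : Fin 4, F.slope j * (clampI (F.xe j.castSucc) (F.xe j.succ) t - F.xe j.castSucc) =
      if j < k then F.ye j.succ - F.ye j.castSucc else if j = k then F.slope k * (t - F.xe k.castSucc) else 0 := by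
    intro j
    have hxj := (F.xe_lt_succ j).le
    split_ifs with h1 h2
    · -- `j < k`: `t ≥ x_{j+1}`
      have hjk : j.succ ≤ k.castSucc := Fin.le_def.2 (by
        simp only [Fin.val_succ, Fin.val_castSucc]; exact Fin.lt_def.1 h1)
      have hle : F.xe j.succ ≤ t := (F.xe_mono.monotone hjk).trans ht.1
      rw [clampI_of_ge hxj hle, slope, div_mul_cancel₀ _ (sub_ne_zero.2 (F.xe_lt_succ j).ne')]
    · subst h2; rw [clampI_of_mem ht]
    · -- `k < j`: `t ≤ x_j`
      have hkj : k < j := lt_of_le_of_ne (not_lt.1 h1) (Ne.symm h2)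
      have hkj' : k.succ ≤ j.castSucc := Fin.le_def.2 (by
        simp only [Fin.val_succ, Fin.val_castSucc]; exact Fin.lt_def.1 hkj)
      have hle : t ≤ F.xe j.castSucc := ht.2.trans (F.xe_mono.monotone hkj')
      rw [clampI_of_le hle, sub_self, mul_zero]
  unfold spline
  rw [Finset.sum_congr rfl fun j _ => hterm j, Fin.sum_univ_four]
  fin_cases k <;> simp <;> ring

/-- **Interpolation**: `spline x_j = y_j` (`j = 0, …, 4`). [folklore] -/
theorem spline_apply_xe (j : Fin 5) : F.spline (F.xe j) = F.ye j := by
  rcases Fin.eq_castSucc_or_eq_last j with ⟨k, rfl⟩ | rfl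
  · rw [F.spline_eq_of_mem k ⟨le_rfl, (F.xe_lt_succ k).le⟩, sub_self, mul_zero, add_zero]
  · have := F.spline_eq_of_mem 3 ⟨(F.xe_lt_succ 3).le, le_rfl⟩
    rw [show (Fin.last 4 : Fin 5) = (3 : Fin 4).succ from rfl, this, slope,
      div_mul_cancel₀ _ (sub_ne_zero.2 (F.xe_lt_succ 3).ne')]
    simp

/-- The spline is monotone. [folklore] -/
theorem monotone_spline : Monotone F.spline := by
  intro s t hst
  unfold spline
  refine add_le_add le_rfl (Finset.sum_le_sum fun j _ => ?_)
  exact mul_le_mul_of_nonneg_left (sub_le_sub_right (monotone_clampI _ _ hst) _) (F.slope_pos j).le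

/-- A Lipschitz constant for the spline: the sum of the slopes (at least each slope). [folklore] -/
def lip : ℝ≥0 := ∑ j : Fin 4, (F.slope j).toNNReal

/-- Structural lemma for the four-knot data. [folklore] -/
theorem slope_le_lip (j : Fin 4) : F.slope j ≤ F.lip := by
  unfold lip
  have : (F.slope j).toNNReal ≤ ∑ i : Fin 4, (F.slope i).toNNReal :=
    Finset.single_le_sum (fun i _ => (bot_le : (⊥ : ℝ≥0) ≤ (F.slope i).toNNReal)) (Finset.mem_univ j)
  calc F.slope j = ((F.slope j).toNNReal : ℝ) := (Real.coe_toNNReal _ (F.slope_pos j).le).symm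
    _ ≤ _ := by exact_mod_cast this

/-- The spline is Lipschitz. [folklore] -/
theorem lipschitzWith_spline : LipschitzWith F.lip F.spline := by
  unfold spline lip
  refine LipschitzWith.of_dist_le_mul fun s t => ?_
  rw [dist_add_left, NNReal.coe_sum, Finset.sum_mul]
  refine dist_sum_sum_le_of_le _ fun j _ => ?_
  rw [Real.dist_eq, ← mul_sub, abs_mul, abs_of_pos (F.slope_pos j),
    Real.coe_toNNReal _ (F.slope_pos j).le, sub_sub_sub_cancel_right]
  refine mul_le_mul_of_nonneg_left ?_ (F.slope_pos j).le
  have := (lipschitzWith_clampI (F.xe j.castSucc) (F.xe j.succ)).dist_le_mul s t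
  rw [Real.dist_eq, NNReal.coe_one, one_mul] at this
  exact this

/-- Every `t ∈ [x₀, x₀ + 1]` lies in one of the four pieces. [folklore] -/
theorem exists_mem_piece {t : ℝ} (ht : t ∈ Icc (F.x 0) (F.x 0 + 1)) :
    ∃ k : Fin 4, t ∈ Icc (F.xe k.castSucc) (F.xe k.succ) := by
  by_cases h1 : t ≤ F.x 1
  · exact ⟨0, ht.1, h1⟩
  by_cases h2 : t ≤ F.x 2
  · exact ⟨1, (not_le.1 h1).le, h2⟩
  by_cases h3 : t ≤ F.x 3
  · exact ⟨2, (not_le.1 h2).le, h3⟩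
  · exact ⟨3, (not_le.1 h3).le, ht.2⟩

/-- The spline is strictly monotone on each piece. [folklore] -/
theorem strictMonoOn_spline_piece (k : Fin 4) :
    StrictMonoOn F.spline (Icc (F.xe k.castSucc) (F.xe k.succ)) := by
  intro s hs t ht hst
  rw [F.spline_eq_of_mem k hs, F.spline_eq_of_mem k ht]
  have := F.slope_pos k
  nlinarith

/-- The spline is strictly monotone on the fundamental interval. [folklore] -/
theorem strictMonoOn_spline : StrictMonoOn F.spline (Icc (F.x 0) (F.x 0 + 1)) := by
  have h0 := F.strictMonoOn_spline_piece 0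
  have h1 := F.strictMonoOn_spline_piece 1
  have h2 := F.strictMonoOn_spline_piece 2
  have h3 := F.strictMonoOn_spline_piece 3
  simp only [xe_castSucc] at h0 h1 h2 h3
  have e1 : F.xe (0 : Fin 4).succ = F.x 1 := rfl
  have e2 : F.xe (1 : Fin 4).succ = F.x 2 := rfl
  have e3 : F.xe (2 : Fin 4).succ = F.x 3 := rfl
  have e4 : F.xe (3 : Fin 4).succ = F.x 0 + 1 := rfl
  rw [e1] at h0; rw [e2] at h1; rw [e3] at h2; rw [e4] at h3
  have h01 : StrictMonoOn F.spline (Icc (F.x 0) (F.x 2)) := by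
    rw [← Icc_union_Icc_eq_Icc F.hx01.le F.hx12.le]
    exact h0.union h1 (isGreatest_Icc F.hx01.le) (isLeast_Icc F.hx12.le)
  have h02 : StrictMonoOn F.spline (Icc (F.x 0) (F.x 3)) := by
    rw [← Icc_union_Icc_eq_Icc (F.hx01.trans F.hx12).le F.hx23.le]
    exact h01.union h2 (isGreatest_Icc (F.hx01.trans F.hx12).le) (isLeast_Icc F.hx23.le)
  rw [← Icc_union_Icc_eq_Icc ((F.hx01.trans F.hx12).trans F.hx23).le F.hx30.le]
  exact h02.union h3 (isGreatest_Icc ((F.hx01.trans F.hx12).trans F.hx23).le) (isLeast_Icc F.hx30.le)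

/-! ### The inverse spline -/

/-- Swapping sources and targets. [folklore] -/
def swap : FourKnots where
  x := F.y
  y := F.x
  hx01 := F.hy01
  hx12 := F.hy12
  hx23 := F.hy23
  hx30 := F.hy30
  hy01 := F.hx01
  hy12 := F.hx12
  hy23 := F.hx23
  hy30 := F.hx30

/-- Structural lemma for the four-knot data. [folklore] -/
@[simp] theorem swap_x : F.swap.x = F.y := rfl

/-- Structural lemma for the four-knot data. [folklore] -/
@[simp] theorem swap_y : F.swap.y = F.x := rfl

/-- Structural lemma for the four-knot data. [folklore] -/
@[simp] theorem swap_xe (j : Fin 5) : F.swap.xe j = F.ye j := by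
  unfold xe ye swap; rfl

/-- Structural lemma for the four-knot data. [folklore] -/
@[simp] theorem swap_ye (j : Fin 5) : F.swap.ye j = F.xe j := by
  unfold xe ye swap; rfl

/-- Structural lemma for the four-knot data. [folklore] -/
@[simp] theorem swap_swap : F.swap.swap = F := rfl

/-- Structural lemma for the four-knot data. [folklore] -/
theorem swap_slope (j : Fin 4) : F.swap.slope j = (F.slope j)⁻¹ := by
  simp [slope, inv_div]

/-- The spline maps the piece `[x_k, x_{k+1}]` into `[y_k, y_{k+1}]`. [folklore] -/
theorem spline_mem_of_mem (k : Fin 4) {t : ℝ} (ht : t ∈ Icc (F.xe k.castSucc) (F.xe k.succ)) :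
    F.spline t ∈ Icc (F.ye k.castSucc) (F.ye k.succ) := by
  rw [F.spline_eq_of_mem k ht]
  have hs := F.slope_pos k
  have hxlt := F.xe_lt_succ k
  refine ⟨by nlinarith [ht.1], ?_⟩
  have : F.slope k * (t - F.xe k.castSucc) ≤ F.slope k * (F.xe k.succ - F.xe k.castSucc) :=
    mul_le_mul_of_nonneg_left (by linarith [ht.2]) hs.le
  rw [slope, div_mul_cancel₀ _ (sub_ne_zero.2 hxlt.ne')] at this
  rw [slope]; linarith

/-- **The swapped spline inverts the spline on the fundamental interval.** [folklore] -/
theorem spline_swap_spline {t : ℝ} (ht : t ∈ Icc (F.x 0) (F.x 0 + 1)) :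
    F.swap.spline (F.spline t) = t := by
  obtain ⟨k, hk⟩ := F.exists_mem_piece ht
  have hmem := F.spline_mem_of_mem k hk
  rw [F.swap.spline_eq_of_mem k (by simpa using hmem), F.spline_eq_of_mem k hk, swap_slope]
  simp only [swap_ye, swap_xe]
  have hs := (F.slope_pos k).ne'
  field_simp
  ring

/-- The spline maps the fundamental interval onto the target fundamental interval. [folklore] -/
theorem spline_mem {t : ℝ} (ht : t ∈ Icc (F.x 0) (F.x 0 + 1)) :
    F.spline t ∈ Icc (F.y 0) (F.y 0 + 1) := by
  have h0 := F.spline_apply_xe 0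
  have h4 := F.spline_apply_xe 4
  simp only [xe_zero, ye_zero, xe_four, ye_four] at h0 h4
  exact ⟨h0 ▸ F.monotone_spline ht.1, h4 ▸ F.monotone_spline ht.2⟩

/-! ### The equivariant lift -/

/-- The periodic part `q(r) = spline (x₀ + r) - (x₀ + r)` on `[0, 1]`. [folklore] -/
def perPart (r : ℝ) : ℝ := F.spline (F.x 0 + r) - (F.x 0 + r)

/-- Structural lemma for the four-knot data. [folklore] -/
theorem perPart_zero_eq_one : F.perPart 0 = F.perPart 1 := by
  unfold perPart
  have h0 := F.spline_apply_xe 0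
  have h4 := F.spline_apply_xe 4
  simp only [xe_zero, ye_zero, xe_four, ye_four] at h0 h4
  rw [add_zero, h0, h4]; ring

/-- **The lift** `K t = t + q(fract (t - x₀))`: the equivariant extension of the spline. [folklore] -/
def lift (t : ℝ) : ℝ := t + F.perPart (Int.fract (t - F.x 0))

/-- `K = spline (t - n) + n` with `n = ⌊t - x₀⌋`. [folklore] -/
theorem lift_eq (t : ℝ) : F.lift t = F.spline (t - ⌊t - F.x 0⌋) + ⌊t - F.x 0⌋ := by
  unfold lift perPart
  rw [← Int.self_sub_floor]
  ring_nf

/-- On the fundamental interval `[x₀, x₀ + 1)` the lift is the spline. [folklore] -/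
theorem lift_eq_spline {t : ℝ} (ht : t ∈ Ico (F.x 0) (F.x 0 + 1)) : F.lift t = F.spline t := by
  rw [lift_eq]
  have : ⌊t - F.x 0⌋ = 0 := Int.floor_eq_zero_iff.2 ⟨by linarith [ht.1], by linarith [ht.2]⟩
  rw [this]; simp

/-- **Equivariance**: `K (t + 1) = K t + 1`. [folklore] -/
theorem lift_add_one (t : ℝ) : F.lift (t + 1) = F.lift t + 1 := by
  unfold lift
  rw [show t + 1 - F.x 0 = (t - F.x 0) + 1 by ring, Int.fract_add_one]
  ring

/-- `K (t + n) = K t + n`. [folklore] -/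
theorem lift_add_intCast (t : ℝ) (n : ℤ) : F.lift (t + n) = F.lift t + n := by
  unfold lift
  rw [show t + n - F.x 0 = (t - F.x 0) + n by ring, Int.fract_add_intCast]
  ring

/-- The lift at the knots: `K (x_j) = y_j`. [folklore] -/
theorem lift_apply_x (j : Fin 4) : F.lift (F.x j) = F.y j := by
  have hlo : F.x 0 ≤ F.x j := by
    have := F.xe_mono.monotone (Fin.zero_le (Fin.castSucc j))
    simpa using this
  have hhi : F.x j < F.x 0 + 1 := by
    have h3 : F.xe (Fin.castSucc j) ≤ F.xe (Fin.castSucc 3) :=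
      F.xe_mono.monotone (Fin.le_def.2 (by simpa using Nat.lt_succ_iff.1 j.is_lt))
    simp only [xe_castSucc] at h3
    exact h3.trans_lt F.hx30
  rw [F.lift_eq_spline ⟨hlo, hhi⟩]
  have := F.spline_apply_xe (Fin.castSucc j)
  simpa using this

/-- **Continuity of the lift** (`q(0) = q(1)`). [folklore] -/
theorem continuous_lift : Continuous F.lift := by
  unfold lift
  refine continuous_id.add ?_
  have hq : Continuous (F.perPart ∘ Int.fract) :=
    ContinuousOn.comp_fract'' ((F.lipschitzWith_spline.continuous.comp (continuous_const.add
      continuous_id)).sub (continuous_const.add continuous_id)).continuousOn F.perPart_zero_eq_one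
  exact hq.comp (continuous_id.sub continuous_const)

/-- The lift is strictly monotone on the closed fundamental interval. [folklore] -/
theorem strictMonoOn_lift : StrictMonoOn F.lift (Icc (F.x 0) (F.x 0 + 1)) := by
  intro s hs t ht hst
  have hs' : s ∈ Ico (F.x 0) (F.x 0 + 1) := ⟨hs.1, hst.trans_le ht.2⟩
  rw [F.lift_eq_spline hs']
  rcases ht.2.eq_or_lt with heq | hlt
  · rw [heq, F.lift_add_one, show F.lift (F.x 0) = F.y 0 from F.lift_apply_x 0]
    have := F.spline_mem ⟨hs.1, hs.2⟩
    have hne : F.spline s ≠ F.y 0 + 1 := by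
      intro h
      have h4 := F.spline_apply_xe 4
      simp only [xe_four, ye_four] at h4
      have := F.strictMonoOn_spline ⟨hs.1, hs.2⟩ ⟨by linarith, le_rfl⟩ hs'.2
      rw [h, h4] at this; exact lt_irrefl _ this
    exact lt_of_le_of_ne this.2 hne
  · rw [F.lift_eq_spline ⟨ht.1, hlt⟩]
    exact F.strictMonoOn_spline ⟨hs.1, hs.2⟩ ⟨ht.1, ht.2⟩ hst

/-- **The lift is strictly increasing on `ℝ`.** [folklore] -/
theorem strictMono_lift : StrictMono F.lift := by
  intro s t hst
  set m : ℤ := ⌊s - F.x 0⌋ with hm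
  set s' := s - m with hs'
  set t' := t - m with ht'
  have hs'0 : F.x 0 ≤ s' := by rw [hs']; linarith [Int.floor_le (s - F.x 0)]
  have hs'1 : s' < F.x 0 + 1 := by rw [hs']; linarith [Int.lt_floor_add_one (s - F.x 0)]
  have hs't' : s' < t' := by rw [hs', ht']; linarith
  have hKs : F.lift s = F.lift s' + m := by rw [← F.lift_add_intCast s' m, hs']; ring_nf
  have hKt : F.lift t = F.lift t' + m := by rw [← F.lift_add_intCast t' m, ht']; ring_nf
  rw [hKs, hKt]
  suffices F.lift s' < F.lift t' by linarith
  rcases le_or_gt t' (F.x 0 + 1) with ht'1 | ht'1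
  · exact F.strictMonoOn_lift ⟨hs'0, hs'1.le⟩ ⟨hs'0.trans hs't'.le, ht'1⟩ hs't'
  · have hlt : F.lift s' < F.lift (F.x 0 + 1) := F.strictMonoOn_lift ⟨hs'0, hs'1.le⟩ ⟨by linarith, le_rfl⟩ hs'1
    set n : ℤ := ⌊t' - F.x 0⌋ with hn
    have hn1 : (1 : ℝ) ≤ n := by
      have : (1 : ℤ) ≤ n := Int.le_floor.2 (by push_cast; linarith)
      exact_mod_cast this
    have ht''0 : F.x 0 ≤ t' - n := by linarith [Int.floor_le (t' - F.x 0)]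
    have ht''1 : t' - n < F.x 0 + 1 := by linarith [Int.lt_floor_add_one (t' - F.x 0)]
    have hK0le : F.lift (F.x 0) ≤ F.lift (t' - n) :=
      F.strictMonoOn_lift.monotoneOn ⟨le_rfl, by linarith⟩ ⟨ht''0, ht''1.le⟩ ht''0
    have hKt' : F.lift t' = F.lift (t' - n) + n := by rw [← F.lift_add_intCast (t' - n) n]; ring_nf
    have hK1' : F.lift (F.x 0 + 1) = F.lift (F.x 0) + 1 := F.lift_add_one _
    rw [hKt']
    linarith

/-- The Lipschitz constant of the lift: `max 1 lip`. [folklore] -/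
def liftLip : ℝ≥0 := max 1 F.lip

/-- One-sided Lipschitz bound for the (monotone) lift. [folklore] -/
theorem lift_sub_lift_le {t s : ℝ} (hts : t ≤ s) : F.lift s - F.lift t ≤ F.liftLip * (s - t) := by
  have hL1 : (1 : ℝ) ≤ F.liftLip := by unfold liftLip; exact_mod_cast le_max_left _ _
  have hLs : ∀ {a b : ℝ}, a ∈ Icc (F.x 0) (F.x 0 + 1) → b ∈ Icc (F.x 0) (F.x 0 + 1) → a ≤ b →
      F.spline b - F.spline a ≤ F.liftLip * (b - a) := by
    intro a b ha hb hab
    have h := F.lipschitzWith_spline.dist_le_mul b a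
    rw [Real.dist_eq, Real.dist_eq, abs_of_nonneg (sub_nonneg.2 (F.monotone_spline hab)),
      abs_of_nonneg (sub_nonneg.2 hab)] at h
    refine h.trans (mul_le_mul_of_nonneg_right ?_ (sub_nonneg.2 hab))
    unfold liftLip; exact_mod_cast le_max_right _ _
  have h0 := F.spline_apply_xe 0
  have h4 := F.spline_apply_xe 4
  simp only [xe_zero, ye_zero, xe_four, ye_four] at h0 h4
  set nt : ℤ := ⌊t - F.x 0⌋ with hnt
  set ns : ℤ := ⌊s - F.x 0⌋ with hns
  set t' : ℝ := t - nt with ht'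
  set s' : ℝ := s - ns with hs'
  have ht'm : t' ∈ Icc (F.x 0) (F.x 0 + 1) :=
    ⟨by rw [ht']; linarith [Int.floor_le (t - F.x 0)], by rw [ht']; linarith [Int.lt_floor_add_one (t - F.x 0)]⟩
  have hs'm : s' ∈ Icc (F.x 0) (F.x 0 + 1) :=
    ⟨by rw [hs']; linarith [Int.floor_le (s - F.x 0)], by rw [hs']; linarith [Int.lt_floor_add_one (s - F.x 0)]⟩
  have hKt : F.lift t = F.spline t' + nt := by rw [F.lift_eq t]
  have hKs : F.lift s = F.spline s' + ns := by rw [F.lift_eq s]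
  have hnle : nt ≤ ns := Int.floor_mono (by linarith)
  rcases hnle.eq_or_lt with heq | hlt
  · -- same period
    have hts' : t' ≤ s' := by rw [ht', hs', heq]; linarith
    rw [hKs, hKt, heq]
    have := hLs ht'm hs'm hts'
    have hst : s' - t' = s - t := by rw [hs', ht', heq]; ring
    rw [hst] at this
    linarith
  · -- `s` is at least one period later
    have h1 : (1 : ℝ) ≤ (ns : ℝ) - nt := by
      have : nt + 1 ≤ ns := hlt
      have : ((nt : ℝ) + 1) ≤ ns := by exact_mod_cast this
      linarith
    have hA : F.spline s' - F.y 0 ≤ F.liftLip * (s' - F.x 0) := by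
      have := hLs ⟨le_rfl, by linarith⟩ hs'm hs'm.1; rwa [h0] at this
    have hB : F.y 0 + 1 - F.spline t' ≤ F.liftLip * (F.x 0 + 1 - t') := by
      have := hLs ht'm ⟨by linarith, le_rfl⟩ ht'm.2; rwa [h4] at this
    rw [hKs, hKt]
    have hst : s - t = (ns - nt - 1 : ℝ) + ((s' - F.x 0) + (F.x 0 + 1 - t')) := by
      rw [hs', ht']; ring
    rw [hst]
    have hC : ((ns : ℝ) - nt - 1) ≤ F.liftLip * ((ns : ℝ) - nt - 1) := by
      have : 0 ≤ (ns : ℝ) - nt - 1 := by linarith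
      nlinarith
    nlinarith [hA, hB, hC]

/-- **The lift is Lipschitz.** [folklore] -/
theorem lipschitzWith_lift : LipschitzWith F.liftLip F.lift := by
  refine LipschitzWith.of_le_add_mul F.liftLip fun a b => ?_
  rcases le_total a b with hab | hba
  · have := F.strictMono_lift.monotone hab
    have : 0 ≤ (F.liftLip : ℝ) * dist a b := by positivity
    linarith
  · have h := F.lift_sub_lift_le hba
    rw [Real.dist_eq, abs_of_nonneg (sub_nonneg.2 hba)]
    linarith

/-- **The lift of the swapped data inverts the lift** (left inverse). [folklore] -/
theorem lift_swap_lift (t : ℝ) : F.swap.lift (F.lift t) = t := by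
  -- reduce to the fundamental interval
  set n : ℤ := ⌊t - F.x 0⌋ with hn
  set t' : ℝ := t - n with ht'
  have ht'm : t' ∈ Ico (F.x 0) (F.x 0 + 1) :=
    ⟨by rw [ht']; linarith [Int.floor_le (t - F.x 0)], by rw [ht']; linarith [Int.lt_floor_add_one (t - F.x 0)]⟩
  have ht : t = t' + n := by rw [ht']; ring
  rw [ht, F.lift_add_intCast, F.swap.lift_add_intCast, F.lift_eq_spline ht'm]
  congr 1
  -- `spline t'` is in the swapped fundamental interval `[y₀, y₀ + 1)` unless `t' = …`; use `Icc`
  have hmem := F.spline_mem ⟨ht'm.1, ht'm.2.le⟩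
  rcases hmem.2.eq_or_lt with heq | hlt
  · -- `spline t' = y₀ + 1` forces `t' = x₀ + 1`, excluded
    exfalso
    have h4 := F.spline_apply_xe 4
    simp only [xe_four, ye_four] at h4
    have := F.strictMonoOn_spline ⟨ht'm.1, ht'm.2.le⟩ ⟨by linarith, le_rfl⟩ ht'm.2
    rw [heq, h4] at this
    exact lt_irrefl _ this
  · rw [F.swap.lift_eq_spline ⟨by simpa using hmem.1, by simpa using hlt⟩]
    exact F.spline_swap_spline ⟨ht'm.1, ht'm.2.le⟩

/-- Right inverse. [folklore] -/
theorem lift_lift_swap (t : ℝ) : F.lift (F.swap.lift t) = t := by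
  simpa using F.swap.lift_swap_lift t

/-- **The lift as a homeomorphism of `ℝ`.** [folklore] -/
def liftHomeomorph : ℝ ≃ₜ ℝ where
  toFun := F.lift
  invFun := F.swap.lift
  left_inv := F.lift_swap_lift
  right_inv := F.lift_lift_swap
  continuous_toFun := F.continuous_lift
  continuous_invFun := F.swap.continuous_lift

/-- Structural lemma for the four-knot data. [folklore] -/
@[simp] theorem liftHomeomorph_apply (t : ℝ) : F.liftHomeomorph t = F.lift t := rfl
/-- Structural lemma for the four-knot data. [folklore] -/
@[simp] theorem liftHomeomorph_symm_apply (t : ℝ) : F.liftHomeomorph.symm t = F.swap.lift t := rfl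

end FourKnots

end Literature.Topology.PlaneTopology

end
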